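import Literature.AnabelianGeometry.SemiGraphs.ProSigmaSurfaceCuspTransvection
import Literature.AnabelianGeometry.SemiGraphs.ProSigmaHeisenbergSeparation
import HarnessLib

/-!
# Cusp classes are NOT characteristic in a pro-`Σ` surface group of genus `≥ 2` — any number of
# cusps, in particular ONE: the handle swap `a₁ ↔ b₁`

Mochizuki, *Semi-graphs of anabelioids* [SemiAnbd] Example 2.10 p. 31 (pro-`Σ` completions
`ι : Γ_{g,r} → Π` of punctured surface groups, cusp inertia subgroups `closure ι⟨c_j⟩`); *Topics in
Absolute Anabelian Geometry I* [AbsTopI] Lemma 4.5 (v) p. 55 ("a group-theoretic characterization of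
the decomposition groups of cusps in `Π`", which print derives from (iii), the WEIGHTS of the
arithmetic Galois action).

PROOF-ONLY file (abc-iut cell, FACT-LIST row F-0206 `CuspidalAlgorithm.RecoversCusps`, seat
abc-iut-f-060 gen 6; tightness of [AbsTopI] Lemma 4.5 (v), complement to
`ProSigmaSurfaceCuspTransvection.lean`, which needs `r ≥ 2`).  For every genus `g ≥ 2`, EVERY number
of cusps `r ≥ 1` — so in particular for the ONE-CUSP types `(g, 1)`, where `c₁ = (∏ᵢ[aᵢ,bᵢ])⁻¹` is a
product of commutators and every abelian character is blind — and every pro-`Σ` completion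
`ι : Γ_{g,r} → Π` (`Σ` containing a prime), there is a continuous automorphism `ê : Π ≅ Π` such that
`ê(closure ι⟨c₁⟩)` is NOT a `Π`-conjugate of ANY cusp inertia group `closure ι⟨c_y⟩`
(`exists_continuousMulEquiv_map_cuspInertia_not_conj_of_genus`).  Construction: `Γ_{g,r}` is free
on `a₁, b₁, …, a_g, b_g, c₂, …, c_r` (`PuncturedSurfaceGroup.freeEquiv`), the HANDLE SWAP
`a₁ ↔ b₁` (a permutation of the free basis, `FreeGroup.freeGroupCongr`) is an automorphism `β` with
`β(c₁) = ([b₁,a₁]·[a₂,b₂]⋯[a_g,b_g])⁻¹ (c₂⋯c_r)⁻¹`; `ι ∘ β` is again a pro-`Σ` completion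
(`IsProSigmaCompletion.comp_mulEquiv`), so `β` extends to `ê` (`exists_continuousMulEquiv`).
Detection by a NON-ABELIAN `p`-group (`p ∈ Σ`): in the Heisenberg group `H = (ℤ/p² × ℤ/p²) ⋊ ℤ/p²`
(abc-iut-f-164's `Heisenberg.exists_heisenbergTriple`: `X Y X⁻¹ Y⁻¹ = Z`, `Z^m = 1 ↔ p² ∣ m`) the
character `a₁ ↦ X, b₁ ↦ Y, a₂ ↦ Y, b₂ ↦ X`, all other free generators `↦ 1`, KILLS every cusp
(`c₁ ↦ ([X,Y][Y,X])⁻¹ = 1`) but maps `β(c₁) ↦ ([Y,X][Y,X])⁻¹ = Z² ≠ 1`; its continuous extension to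
`Π` (`exists_continuous_extend_of_card_primePow`) kills every closed cusp inertia group and all their
conjugates, but not `ι(β c₁) ∈ ê(closure ι⟨c₁⟩)`.  Two handles are used: for `g = 1` the swap
inverts `[a₁,b₁]` up to conjugacy and detects nothing (the once-punctured torus `(1,1)` is the one
hyperbolic type with a cusp NOT covered by this file or by the transvection file).

HONEST FRAMING: elementary profinite group theory about surface groups; it shows that the
arithmetic input of [AbsTopI] Lemma 4.5 (iii)/(v) (weights) is NECESSARY also in the one-cusp case;
nothing here bears on [IUTchIII] Cor 3.12; no abc claim.
-/

noncomputable section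

namespace Literature.AnabelianGeometry.SemiGraphs.SemiGraphOfAnabelioids.IsProSigmaCompletion

open scoped Pointwise
open Literature.GroupTheory.CombinatorialGroupTheory
open Literature.AnabelianGeometry.Anabelioids (IsSigmaInteger)

universe u

variable {Sigma : Set ℕ} {g r : ℕ} {Q : Type u} [Group Q] [TopologicalSpace Q] [IsTopologicalGroup Q]
  [CompactSpace Q] [TotallyDisconnectedSpace Q]

/-- The value of a character of the free group on `a₁,b₁,…,a_{g+2},b_{g+2},c₂,…` killing the
handles `3, …, g+2` on `A = ∏ᵢ [aᵢ,bᵢ]`: `[v(a₁),v(b₁)] · [v(a₂),v(b₂)]`.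
[cite: MochizukiSemiAnbd2006, Ex. 2.10 p.31] -/
private theorem lift_commProd_of_two_handles {M : Type*} [Group M]
    (v : (Fin (g + 2) × Bool) ⊕ Fin r → M)
    (hv : ∀ (i : Fin g) (bb : Bool), v (Sum.inl (i.succ.succ, bb)) = 1) :
    FreeGroup.lift v (PuncturedSurfaceGroup.commProd (g + 2) r) =
      (v (Sum.inl (0, false)) * v (Sum.inl (0, true)) * (v (Sum.inl (0, false)))⁻¹ *
          (v (Sum.inl (0, true)))⁻¹) *
        (v (Sum.inl (1, false)) * v (Sum.inl (1, true)) * (v (Sum.inl (1, false)))⁻¹ *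
          (v (Sum.inl (1, true)))⁻¹) := by
  rw [PuncturedSurfaceGroup.commProd, map_list_prod, List.map_map, ← List.ofFn_eq_map, List.ofFn_succ,
    List.ofFn_succ, List.prod_cons, List.prod_cons, List.prod_eq_one, mul_one, Fin.succ_zero_eq_one]
  · simp only [Function.comp_apply, map_mul, map_inv, FreeGroup.lift_apply_of]
  · intro x hx
    obtain ⟨i, rfl⟩ := List.mem_ofFn.mp hx
    simp only [Function.comp_apply, map_mul, map_inv, FreeGroup.lift_apply_of, hv, inv_one, mul_one]

/-- The value of a character of the free group on `a₁,b₁,…,c₂,…` killing `c₂, …` on `B = ∏_{j≥2} c_j`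
is `1`. [cite: MochizukiSemiAnbd2006, Ex. 2.10 p.31] -/
private theorem lift_cuspProd_eq_one {M : Type*} [Group M] {n : ℕ} (v : (Fin n × Bool) ⊕ Fin r → M)
    (hv : ∀ j : Fin r, v (Sum.inr j) = 1) :
    FreeGroup.lift v (PuncturedSurfaceGroup.cuspProd n r) = 1 := by
  rw [PuncturedSurfaceGroup.cuspProd, map_list_prod, List.map_map]
  exact List.prod_eq_one fun x hx => by
    obtain ⟨j, -, rfl⟩ := List.mem_map.mp hx
    rw [Function.comp_apply, FreeGroup.lift_apply_of, hv]

/-- **A pro-`Σ` completion of `Γ_{g,r}` with `g ≥ 2` and `r ≥ 1` — in particular of the ONE-CUSP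
surface group `Γ_{g,1}` — carries a continuous automorphism moving the closed inertia group of the
cusp `c₁` (index `0`) off EVERY cuspidal conjugacy class**: `ê(closure ι⟨c₁⟩) ≠ q · closure ι⟨c_y⟩ · q⁻¹`
for all cusps `y` and all `q ∈ Π`.  (`ê` extends the handle swap `a₁ ↔ b₁` of the free group
`Γ_{g,r}`; a Heisenberg-group-valued character over `ℤ/p²`, `p ∈ Σ`, killing every cusp but not
`β(c₁) ↦ Z²` separates — conjugation cannot resurrect a killed subgroup.)  Hence the conjugacy classes
of cusp inertia subgroups of a pro-`Σ` surface group of genus `≥ 2` are NOT preserved by its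
continuous automorphisms, for any number `≥ 1` of cusps: the "group-theoretic characterization of the
decomposition groups of cusps" of [AbsTopI] Lemma 4.5 (v) needs the arithmetic quotient `Π ↠ G_k`
(weights, Lemma 4.5 (iii)) also in the one-cusp case, where all abelian characters are blind.
[cite: MochizukiAbsTopI2012, Lemma 4.5 (v) p.55] [cite: MochizukiSemiAnbd2006, Ex. 2.10 p.31] -/
theorem exists_continuousMulEquiv_map_cuspInertia_not_conj_of_genus (hne : Sigma.Nonempty)
    (hprime : ∀ p ∈ Sigma, p.Prime)
    (ι : PuncturedSurfaceGroup (g + 2) (r + 1) →* Q) (hι : IsProSigmaCompletion Sigma ι) :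
    ∃ e : Q ≃ₜ* Q, ∀ (y : Fin (r + 1)) (q : Q),
      ((PuncturedSurfaceGroup.cuspInertia (g := g + 2) (0 : Fin (r + 1))).map ι).topologicalClosure.map
          e.toMulEquiv.toMonoidHom ≠
        ConjAct.toConjAct q •
          ((PuncturedSurfaceGroup.cuspInertia (g := g + 2) y).map ι).topologicalClosure := by
  classical
  obtain ⟨p, hpS⟩ := hne
  have hp : p.Prime := hprime p hpS
  -- the Heisenberg group `H = (ℤ/p² × ℤ/p²) ⋊ ℤ/p²` of order `p⁶` and its triple `[X,Y] = Z`
  obtain ⟨φ, X, Y, Z, hXYZ, hZpow, hcard⟩ := Heisenberg.exists_heisenbergTriple (p ^ 2)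
  let M : Type := Multiplicative (ZMod (p ^ 2) × ZMod (p ^ 2)) ⋊[φ] Multiplicative (ZMod (p ^ 2))
  letI : TopologicalSpace M := ⊥
  haveI : DiscreteTopology M := ⟨rfl⟩
  have hM : Nat.card M = p ^ 6 := by
    change Nat.card (Multiplicative (ZMod (p ^ 2) × ZMod (p ^ 2)) ⋊[φ] Multiplicative (ZMod (p ^ 2))) = _
    rw [hcard, ← pow_mul]
  haveI : Finite M := Nat.finite_of_card_ne_zero (by rw [hM]; exact pow_ne_zero _ hp.ne_zero)
  have hYX : Y * X * Y⁻¹ * X⁻¹ = Z⁻¹ := by rw [← hXYZ]; group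
  -- the letters of the free basis of `Γ_{g+2,r+1}`: `aᵢ, bᵢ` (`inl`) and `c₂, …, c_{r+1}` (`inr`)
  let L : Type := (Fin (g + 2) × Bool) ⊕ Fin r
  let a₀ : L := Sum.inl (0, false)
  let b₀ : L := Sum.inl (0, true)
  have h10 : (1 : Fin (g + 2)) ≠ 0 := by simp
  have hss0 : ∀ i : Fin g, i.succ.succ ≠ 0 := fun i => Fin.succ_ne_zero _
  have hss1 : ∀ i : Fin g, i.succ.succ ≠ 1 := fun i h => by
    have := congrArg Fin.val h
    simp only [Fin.val_succ, Fin.val_one] at this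
    omega
  -- the detection weights: handle 1 ↦ (X, Y), handle 2 ↦ (Y, X), everything else ↦ 1
  let w : L → M := Sum.elim
    (fun ib => if ib.1 = 0 then (if ib.2 = true then Y else X)
      else if ib.1 = 1 then (if ib.2 = true then X else Y) else 1)
    (fun _ => 1)
  have hwa0 : w a₀ = X := by simp [w, a₀]
  have hwb0 : w b₀ = Y := by simp [w, b₀]
  have hwa1 : w (Sum.inl (1, false)) = Y := by simp [w, h10]
  have hwb1 : w (Sum.inl (1, true)) = X := by simp [w, h10]
  have hw2 : ∀ (i : Fin g) (bb : Bool), w (Sum.inl (i.succ.succ, bb)) = 1 := fun i bb => by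
    simp [w, hss0 i, hss1 i]
  have hwc : ∀ j : Fin r, w (Sum.inr j) = 1 := fun j => rfl
  -- the swap `σ : a₁ ↔ b₁` of letters and the weights `w ∘ σ`
  let σ : L ≃ L := Equiv.swap a₀ b₀
  have hσa0 : σ a₀ = b₀ := Equiv.swap_apply_left _ _
  have hσb0 : σ b₀ = a₀ := Equiv.swap_apply_right _ _
  have hσfix : ∀ x : L, x ≠ a₀ → x ≠ b₀ → σ x = x := fun x h h' => Equiv.swap_apply_of_ne_of_ne h h'
  have hinl : ∀ (i : Fin (g + 2)) (bb bb' : Bool), i ≠ 0 → (Sum.inl (i, bb) : L) ≠ Sum.inl (0, bb') :=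
    fun i bb bb' hi h => hi (Prod.ext_iff.mp (Sum.inl_injective h)).1
  have hσa1 : σ (Sum.inl (1, false)) = Sum.inl (1, false) :=
    hσfix _ (hinl 1 false false h10) (hinl 1 false true h10)
  have hσb1 : σ (Sum.inl (1, true)) = Sum.inl (1, true) :=
    hσfix _ (hinl 1 true false h10) (hinl 1 true true h10)
  have hσ2 : ∀ (i : Fin g) (bb : Bool), σ (Sum.inl (i.succ.succ, bb)) = Sum.inl (i.succ.succ, bb) :=
    fun i bb => hσfix _ (hinl _ bb false (hss0 i)) (hinl _ bb true (hss0 i))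
  have hσc : ∀ j : Fin r, σ (Sum.inr j) = Sum.inr j := fun j =>
    hσfix _ Sum.inr_ne_inl Sum.inr_ne_inl
  -- the two characters `φM = lift w` and `ψM = lift (w ∘ σ)` of the free group
  let φM : FreeGroup L →* M := FreeGroup.lift w
  let ψM : FreeGroup L →* M := FreeGroup.lift (w ∘ σ)
  have hφA : φM (PuncturedSurfaceGroup.commProd (g + 2) r) = 1 := by
    change FreeGroup.lift w _ = 1
    rw [lift_commProd_of_two_handles w hw2]
    change w a₀ * w b₀ * (w a₀)⁻¹ * (w b₀)⁻¹ * _ = 1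
    rw [hwa0, hwb0, hwa1, hwb1, hXYZ, hYX, mul_inv_cancel]
  have hφB : φM (PuncturedSurfaceGroup.cuspProd (g + 2) r) = 1 := lift_cuspProd_eq_one w hwc
  have hψA : ψM (PuncturedSurfaceGroup.commProd (g + 2) r) = Z⁻¹ * Z⁻¹ := by
    change FreeGroup.lift (w ∘ σ) _ = _
    rw [lift_commProd_of_two_handles (w ∘ σ) (fun i bb => by rw [Function.comp_apply, hσ2, hw2])]
    change w (σ a₀) * w (σ b₀) * (w (σ a₀))⁻¹ * (w (σ b₀))⁻¹ *
      (w (σ (Sum.inl (1, false))) * w (σ (Sum.inl (1, true))) * (w (σ (Sum.inl (1, false))))⁻¹ *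
        (w (σ (Sum.inl (1, true))))⁻¹) = _
    rw [hσa0, hσb0, hσa1, hσb1, hwa0, hwb0, hwa1, hwb1, hYX]
  have hψB : ψM (PuncturedSurfaceGroup.cuspProd (g + 2) r) = 1 :=
    lift_cuspProd_eq_one (w ∘ σ) fun j => by rw [Function.comp_apply, hσc, hwc]
  -- the handle swap `θ` of the free group, `β` of `Γ_{g+2,r+1}`, and `φM ∘ θ = ψM`
  let θ : FreeGroup L ≃* FreeGroup L := FreeGroup.freeGroupCongr σ
  have hφθ : ∀ x, φM (θ x) = ψM x := fun x => by
    have hcomp : φM.comp θ.toMonoidHom = ψM := FreeGroup.ext_hom _ _ fun t => by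
      change FreeGroup.lift w (FreeGroup.freeGroupCongr σ (FreeGroup.of t)) =
        FreeGroup.lift (w ∘ σ) (FreeGroup.of t)
      rw [FreeGroup.freeGroupCongr_apply, FreeGroup.map.of, FreeGroup.lift_apply_of,
        FreeGroup.lift_apply_of, Function.comp_apply]
    exact DFunLike.congr_fun hcomp x
  let fe := PuncturedSurfaceGroup.freeEquiv (g + 2) r
  let β : PuncturedSurfaceGroup (g + 2) (r + 1) ≃* PuncturedSurfaceGroup (g + 2) (r + 1) :=
    fe.trans (θ.trans fe.symm)
  have hfeβ : ∀ γ, fe (β γ) = θ (fe γ) := fun γ => by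
    change fe (fe.symm (θ (fe γ))) = _
    rw [MulEquiv.apply_symm_apply]
  obtain ⟨e, he⟩ := hι.exists_continuousMulEquiv (hι.comp_mulEquiv β)
  -- the character `f = φM ∘ fe` of `Γ_{g+2,r+1}` and its continuous extension `F` to `Π`
  let f : PuncturedSurfaceGroup (g + 2) (r + 1) →* M := φM.comp fe.toMonoidHom
  have hf : ∀ γ, f γ = φM (fe γ) := fun γ => rfl
  obtain ⟨F, hFc, hFι⟩ := hι.exists_continuous_extend_of_card_primePow hp hpS (k := 6) hM f
  -- `f` kills every cusp …
  have hfc : ∀ y : Fin (r + 1), f (PuncturedSurfaceGroup.c y) = 1 := fun y => by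
    refine Fin.cases ?_ (fun j => ?_) y
    · rw [hf, PuncturedSurfaceGroup.freeEquiv_c_zero, map_mul, map_inv, map_inv, hφA, hφB, inv_one,
        mul_one]
    · rw [hf, PuncturedSurfaceGroup.freeEquiv_c_succ]
      change FreeGroup.lift w (FreeGroup.of _) = 1
      rw [FreeGroup.lift_apply_of, hwc]
  -- … but not the swapped cusp `β(c₁) ↦ Z²`
  have hfβ : f (β (PuncturedSurfaceGroup.c 0)) = Z * Z := by
    rw [hf, hfeβ, hφθ, PuncturedSurfaceGroup.freeEquiv_c_zero, map_mul, map_inv, map_inv, hψA, hψB,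
      inv_one, mul_one, mul_inv_rev, inv_inv]
  have hZZ : Z * Z ≠ 1 := fun h => by
    have h2 : p ^ 2 ∣ 2 := (hZpow 2).mp ((pow_two Z).trans h)
    have h4 : 2 * 2 ≤ p ^ 2 := by rw [pow_two]; exact Nat.mul_le_mul hp.two_le hp.two_le
    have := Nat.le_of_dvd two_pos h2
    omega
  -- conclusion
  refine ⟨e, fun y q heq => hZZ ?_⟩
  -- `ι(β c₁) ∈ ê(Ī₁) = q Ī_y q⁻¹`, then apply `F`
  have hmem : ι (β (PuncturedSurfaceGroup.c 0)) ∈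
      ((PuncturedSurfaceGroup.cuspInertia (g := g + 2) (0 : Fin (r + 1))).map ι).topologicalClosure.map
        e.toMulEquiv.toMonoidHom := by
    refine ⟨ι (PuncturedSurfaceGroup.c 0), Subgroup.le_topologicalClosure _
      ⟨PuncturedSurfaceGroup.c 0, Subgroup.mem_zpowers _, rfl⟩, ?_⟩
    change e (ι _) = _
    rw [he]
    rfl
  rw [heq, Subgroup.mem_smul_pointwise_iff_exists] at hmem
  obtain ⟨z, hz, hzeq⟩ := hmem
  have hFz : F z = 1 := by
    have h1 : F z ∈ Subgroup.zpowers (f (PuncturedSurfaceGroup.c y)) := by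
      rw [← hFι]
      refine map_topologicalClosure_zpowers_le F hFc (ι (PuncturedSurfaceGroup.c y)) ⟨z, ?_, rfl⟩
      rw [← MonoidHom.map_zpowers]
      exact hz
    rwa [hfc y, Subgroup.zpowers_one_eq_bot, Subgroup.mem_bot] at h1
  have hFβ : F (ι (β (PuncturedSurfaceGroup.c 0))) = 1 := by
    rw [← hzeq, ConjAct.smul_def, map_mul, map_mul, map_inv, hFz, mul_one, mul_inv_cancel]
  rwa [hFι, hfβ] at hFβ

end Literature.AnabelianGeometry.SemiGraphs.SemiGraphOfAnabelioids.IsProSigmaCompletion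

end
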